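import Mathlib
import Summits.Ventures.PercRepro2.Defs
import Summits.Ventures.PercRepro2.Independence
import Summits.Ventures.PercRepro2.Harris
import Summits.Ventures.PercRepro2.Graph
import Summits.Ventures.PercRepro2.Exploration
import Summits.Ventures.PercRepro2.GriffithsOne
import Summits.Ventures.PercRepro2.Induced
import Summits.Ventures.PercRepro2.VdBKahn
import Summits.Ventures.PercRepro2.NestIID
import Summits.Ventures.PercRepro2.IIDRows
import Summits.Ventures.PercRepro2.PartDefs
import Summits.Ventures.PercRepro2.PartFactor
import Summits.Ventures.PercRepro2.PartGriffiths
import Summits.Ventures.PercRepro2.Part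

/-!
# (PART) in mine-1's two-copy vocabulary (blind cell PercRepro2, typer-1; mine-1 g9
`IIDRows.lean`: `clusterLaw`, `unionTerm`; MINE1-IID-UNION.md §1 "(PU-V) at `w ≡ 0` = (PART)")

`coreFreeTerm p ends l x y` is the core-free part of mine-1's union term at the full vertex set:
`Σ_{H₁ ∪ H₂ = V, H₁ ∩ H₂ = {l}} P(C = H₁) P(C′ = H₂) σ_x σ_y`, `σ_v = 1[v ∈ H₁] − 1[v ∈ H₂]` — the
pairs of independent clusters of `l` that PARTITION `V ∖ {l}` (no core). **`coreFreeTerm_nonneg`**: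
it is nonnegative for `x, y ≠ l` — `Part.part_nonneg_finset` after the re-indexing
`(H₁, H₂) ↦ S = H₁ ∖ {l}` (`coreFreeTerm_eq`).
-/

namespace Summit.Ventures.PercRepro2

namespace Part

open Griffiths

open scoped Classical

variable {V : Type*} {E : Type*} [Fintype V] [DecidableEq V] [Fintype E] [DecidableEq E]
  {R : Type*} [Field R] [LinearOrder R] [IsStrictOrderedRing R]

variable (p : E → R) (ends : E → Sym2 V) (l x y : V)

/-- The core-free part of the union term at `V`: the pairs `(H₁, H₂)` with `H₁ ∪ H₂ = V` and
`H₁ ∩ H₂ = {l}` (mine-1's `unionTerm` with the core forbidden). -/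
noncomputable def coreFreeTerm : R :=
  ∑ H₁ : Finset V, ∑ H₂ : Finset V, if H₁ ∪ H₂ = Finset.univ ∧ H₁ ∩ H₂ = {l} then
    clusterLaw p ends l H₁ * clusterLaw p ends l H₂ *
      (((if x ∈ H₁ then 1 else 0) - (if x ∈ H₂ then 1 else 0)) *
        ((if y ∈ H₁ then 1 else 0) - (if y ∈ H₂ then 1 else 0))) else 0

omit [Fintype E] [DecidableEq E] in
/-- The partner of `H₁` in a core-free pair is `(V ∖ H₁) ∪ {l}`, and `l ∈ H₁`. -/
lemma coreFree_pair_iff (H₁ H₂ : Finset V) :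
    (H₁ ∪ H₂ = Finset.univ ∧ H₁ ∩ H₂ = {l}) ↔
      l ∈ H₁ ∧ H₂ = (Finset.univ \ H₁) ∪ {l} := by
  constructor
  · rintro ⟨hU, hI⟩
    have hl₁ : l ∈ H₁ := Finset.mem_of_mem_inter_left (hI ▸ Finset.mem_singleton_self l)
    refine ⟨hl₁, ?_⟩
    ext v
    simp only [Finset.mem_union, Finset.mem_sdiff, Finset.mem_univ, true_and,
      Finset.mem_singleton]
    constructor
    · intro hv
      by_cases hv₁ : v ∈ H₁
      · right
        have : v ∈ H₁ ∩ H₂ := Finset.mem_inter.2 ⟨hv₁, hv⟩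
        rw [hI, Finset.mem_singleton] at this
        exact this
      · exact Or.inl hv₁
    · rintro (hv | hvl)
      · have : v ∈ H₁ ∪ H₂ := hU ▸ Finset.mem_univ v
        exact (Finset.mem_union.1 this).resolve_left hv
      · rw [hvl]
        exact Finset.mem_of_mem_inter_right (hI ▸ Finset.mem_singleton_self l)
  · rintro ⟨hl₁, rfl⟩
    constructor
    · ext v
      simp only [Finset.mem_union, Finset.mem_sdiff, Finset.mem_univ, true_and,
        Finset.mem_singleton, iff_true]
      by_cases hv : v ∈ H₁
      · exact Or.inl hv
      · exact Or.inr (Or.inl hv)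
    · ext v
      simp only [Finset.mem_inter, Finset.mem_union, Finset.mem_sdiff, Finset.mem_univ, true_and,
        Finset.mem_singleton]
      constructor
      · rintro ⟨hv, hv' | hvl⟩
        · exact absurd hv hv'
        · exact hvl
      · intro hvl
        rw [hvl]
        exact ⟨hl₁, Or.inr rfl⟩

omit [Fintype V] [DecidableEq V] [LinearOrder R] [IsStrictOrderedRing R] in
/-- The cluster law on finsets is the cluster event's probability. -/
lemma clusterLaw_eq (H : Finset V) :
    clusterLaw p ends l H = prob p (clusterEvent ends l (↑H : Set V)) := rfl

omit [LinearOrder R] [IsStrictOrderedRing R] in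
/-- **The core-free term is the (PART) sum**: re-index `(H₁, H₂) ↦ S = H₁ ∖ {l}`. -/
theorem coreFreeTerm_eq (hx : x ≠ l) (hy : y ≠ l) :
    coreFreeTerm p ends l x y =
      ∑ S ∈ (Finset.univ.erase l).powerset,
        prob p (clusterEvent ends l (↑S ∪ {l})) * prob p (clusterEvent ends l (↑S)ᶜ) *
          (spin (decide (x ∈ S)) * spin (decide (y ∈ S))) := by
  unfold coreFreeTerm
  -- collapse the inner sum: the partner of `H₁` is unique
  have hinner : ∀ H₁ : Finset V, (∑ H₂ : Finset V, if H₁ ∪ H₂ = Finset.univ ∧ H₁ ∩ H₂ = {l} then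
      clusterLaw p ends l H₁ * clusterLaw p ends l H₂ *
        (((if x ∈ H₁ then 1 else 0) - (if x ∈ H₂ then 1 else 0)) *
          ((if y ∈ H₁ then 1 else 0) - (if y ∈ H₂ then 1 else 0))) else 0) =
      if l ∈ H₁ then
        clusterLaw p ends l H₁ * clusterLaw p ends l ((Finset.univ \ H₁) ∪ {l}) *
          (((if x ∈ H₁ then 1 else 0) - (if x ∈ (Finset.univ \ H₁) ∪ {l} then 1 else 0)) *
            ((if y ∈ H₁ then 1 else 0) - (if y ∈ (Finset.univ \ H₁) ∪ {l} then 1 else 0)))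
      else 0 := by
    intro H₁
    simp only [coreFree_pair_iff]
    rw [Finset.sum_eq_single ((Finset.univ \ H₁) ∪ {l})]
    · by_cases hl : l ∈ H₁
      · rw [if_pos ⟨hl, rfl⟩, if_pos hl]
      · rw [if_neg (fun h => hl h.1), if_neg hl]
    · intro H₂ _ hH₂
      rw [if_neg (fun h => hH₂ h.2)]
    · intro h
      exact absurd (Finset.mem_univ _) h
  simp only [hinner]
  rw [← Finset.sum_filter]
  -- re-index `H₁ ↦ H₁.erase l`
  refine Finset.sum_nbij' (fun H₁ => H₁.erase l) (fun S => insert l S) (fun H₁ hH₁ => ?_)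
    (fun S hS => ?_) (fun H₁ hH₁ => ?_) (fun S hS => ?_) (fun H₁ hH₁ => ?_)
  · rw [Finset.mem_powerset]
    intro v hv
    rw [Finset.mem_erase] at hv ⊢
    exact ⟨hv.1, Finset.mem_univ v⟩
  · rw [Finset.mem_filter]
    exact ⟨Finset.mem_univ _, Finset.mem_insert_self l S⟩
  · rw [Finset.mem_filter] at hH₁
    exact Finset.insert_erase hH₁.2
  · rw [Finset.mem_powerset] at hS
    refine Finset.erase_insert fun h => ?_
    exact (Finset.mem_erase.1 (hS h)).1 rfl
  · rw [Finset.mem_filter] at hH₁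
    obtain ⟨_, hl⟩ := hH₁
    have hx₁ : x ∈ H₁ ↔ x ∈ H₁.erase l := by rw [Finset.mem_erase]; exact ⟨fun h => ⟨hx, h⟩, And.right⟩
    have hy₁ : y ∈ H₁ ↔ y ∈ H₁.erase l := by rw [Finset.mem_erase]; exact ⟨fun h => ⟨hy, h⟩, And.right⟩
    have hS₁ : (↑H₁ : Set V) = ↑(H₁.erase l) ∪ {l} := by
      ext v
      simp only [Finset.coe_erase, Set.mem_union, Set.mem_sdiff, Set.mem_singleton_iff,
        Finset.mem_coe]
      constructor
      · intro hv
        by_cases hvl : v = l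
        · exact Or.inr hvl
        · exact Or.inl ⟨hv, hvl⟩
      · rintro (⟨hv, _⟩ | hvl)
        · exact hv
        · rw [hvl]; exact hl
    have hS₂ : (↑((Finset.univ \ H₁) ∪ {l}) : Set V) = (↑(H₁.erase l))ᶜ := by
      ext v
      simp only [Finset.coe_union, Finset.coe_sdiff, Finset.coe_univ, Finset.coe_singleton,
        Set.mem_union, Set.mem_sdiff, Set.mem_univ, true_and, Set.mem_singleton_iff,
        Set.mem_compl_iff, Finset.coe_erase, Finset.mem_coe]
      constructor
      · rintro (hv | hvl)
        · exact fun h => hv h.1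
        · exact fun h => h.2 hvl
      · intro hv
        by_cases hvl : v = l
        · exact Or.inr hvl
        · exact Or.inl fun h => hv ⟨h, hvl⟩
    rw [clusterLaw_eq, clusterLaw_eq, hS₁, hS₂]
    congr 1
    by_cases hxS : x ∈ H₁.erase l <;> by_cases hyS : y ∈ H₁.erase l <;>
      simp [hx₁, hy₁, hxS, hyS, hx, hy, spin]

/-- **(PART) in the two-copy vocabulary**: the core-free part of mine-1's union term at `V` is
nonnegative for `x, y ≠ l`. -/
theorem coreFreeTerm_nonneg (hp : IsProbVec p) (hx : x ≠ l) (hy : y ≠ l) :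
    0 ≤ coreFreeTerm p ends l x y := by
  rw [coreFreeTerm_eq p ends l x y hx hy]
  exact part_nonneg_finset p ends l hp hx hy

end Part

end Summit.Ventures.PercRepro2
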